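import Literature.Dynamics.Contraction.ComplexConeContractionProofs
import Literature.Dynamics.Contraction.RightHalfPlanePoincare

/-!
# Dubois 2009, Theorem 3.6 (the explicit `δ`-diameter bound for complex matrices) — proof

Discharges the named fact `Literature.Dynamics.Contraction.Dubois2009_thm_3_6` of
`Literature/Dynamics/Contraction/ComplexConeContraction.lean` (statement unchanged there) by
`Dubois2009_thm_3_6_holds`, following the printed proof of

* L. Dubois, *Projective metrics and contraction principles for complex cones*, J. London Math.
  Soc. (2) 79 (2009) 719–737 = arXiv:0811.2930 [Dubois2009], Prop. 3.5 and Thm 3.6, pp. 11–13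
  (read 2026-08-15 on the held arXiv text).

Architecture of the printed proof and its rendering.
1. `A(ℂⁿ₊ ∖ 0) ⊆ Int ℂⁿ₊` is Prop. 3.3 (⇐) under (3.20), which the hypothesis of Thm 3.6 implies
   (`θ⁻¹ ≥ 1`, `strict_of_theta_hyp`): `Dubois2009_thm_1_1_iff_holds` of
   `ComplexConeContractionProofs.lean`.
2. Prop. 3.5, (3.23)–(3.25): for `u, v ∈ Int ℂⁿ₊` a point `z ∈ E_{Int}(u,v)` lies in a disc
   `D̄_kl(u,v)` (Lemma 3.2; after the normalization `ζ = z u_k / v_k` this is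
   `norm_bounds_of_re_nonpos` of `RightHalfPlanePoincare.lean`), whence
   `|z| |u_k| ≤ e^{ρ(a,b)} |v_k|` and `|v_k| ≤ e^{ρ(a,b)} |z| |u_k|` with `a = v_l/v_k`,
   `b = u_l/u_k` (`duboisE_point_bounds`; this is (3.24) together with (3.22) in the form
   `phi_le_poincareExp`, i.e. the two `ρ`-terms of (3.25)).
3. Thm 3.6, `Δ₂`: `a, b ∈ E_{Int}(λ_k, λ_l)` (they pair to zero against `y`, `x`: Lemma 3.1,
   `exists_re_nonpos_mulVec_div`), each in one of the discs `D̄_pq(λ_k,λ_l)` of (3.21)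
   (`re_mul_conj_nonpos_iff_mem_closedBall` of the statement file), whose Poincaré diameters are
   `≤ log((1+θ)/(1−θ))` (`poincareExp_le_of_mem_duboisDisc`) and which are chained through the
   endpoints `a_lq/a_kq ∈ D̄_pq ∩ D̄_qr` ("one checks directly", `poincareExp_div_div_le`):
   `e^{ρ(a,b)} ≤ ((1+θ)/(1−θ))³` (`poincareExp_mulVec_div_le`).
4. Thm 3.6, `Δ₁`: the remaining factor `|v_k u_p / (u_k v_p)|` of (3.25) is the quotient of the
   two points `v_k/v_p`, `u_k/u_p` of `E_{Int}(λ_p, λ_k)`; step 2 at the level of the rows and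
   `|a_kp a_lq| ≤ σ² |a_kq a_lp|` bound it by `σ² ((1+θ)/(1−θ))²` — altogether
   `|z| ≤ σ² ((1+θ)/(1−θ))⁸ |w|` for `z, w ∈ E(Ax, Ay)` (`norm_le_of_mem_duboisE`), i.e.
   `δ ≤ 8 log((1+θ)/(1−θ)) + 2 log σ` (`duboisDelta_le_log`).
The statement file renders the diameter with respect to the CLOSED cone `ℂⁿ₊`; since
`E_{ℂⁿ₊}(u,v) ⊆ E_{Int ℂⁿ₊}(u,v)` the printed computation (done for `E_{Int}`) bounds it.

## References
* [Dubois2009] L. Dubois, J. London Math. Soc. (2) 79 (2009) 719–737 = arXiv:0811.2930,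
  Lemma 3.2 ((3.17)–(3.18)), Prop. 3.3 ((3.20)–(3.21)), Prop. 3.5 ((3.22)–(3.25)), Thm 3.6,
  pp. 9–13; Thm 1.1 (p. 2).
-/

noncomputable section

open scoped ComplexConjugate ENNReal
open Set

namespace Literature.Dynamics.Contraction

section Thm36

variable {n : ℕ}

/-- `Re(p/q) > 0` as soon as `Re(p conj q) > 0`. [folklore] -/
theorem div_re_pos {p q : ℂ} (h : 0 < (p * conj q).re) : 0 < (p / q).re := by
  have hq : q ≠ 0 := by
    rintro rfl
    rw [map_zero, mul_zero, Complex.zero_re] at h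
    exact lt_irrefl 0 h
  have e : p / q = p * conj q / (Complex.normSq q : ℂ) := by
    rw [div_eq_div_iff hq (by exact_mod_cast (Complex.normSq_pos.2 hq).ne'), ← Complex.mul_conj]
    ring
  rw [e, Complex.div_ofReal_re]
  exact div_pos h (Complex.normSq_pos.2 hq)

/-- Under `θ⁻¹ |x_l y_k − x_k y_l| < Re(conj x_l · y_k + conj x_k · y_l)` the disc `D̄_kl(x,y)` of
(3.17)/(3.21) satisfies `r_kl < θ Re c_kl`. [cite: Dubois2009, (3.21), proof of Thm 3.6] -/
theorem duboisRadius_lt_mul_re_duboisCenter {x y : Fin n → ℂ} {k l : Fin n} {θ : ℝ}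
    (hθ0 : 0 < θ) (hρ : 0 < (x k * conj (x l)).re)
    (hyp : θ⁻¹ * ‖x l * y k - x k * y l‖ < (conj (x l) * y k + conj (x k) * y l).re) :
    duboisRadius x y k l < θ * (duboisCenter x y k l).re := by
  have h2 : 0 < 2 * (x k * conj (x l)).re := by linarith
  rw [duboisRadius, duboisCenter, Complex.div_ofReal_re, mul_div_assoc']
  exact div_lt_div_of_pos_right ((inv_mul_lt_iff₀ hθ0).1 hyp) h2

/-- The discs `D̄_pq(λ_k, λ_l)` of (3.21) lie in the open right half-plane `{Re > 0}` when (3.20)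
holds ("`Re(c_pq(λ_k,λ_l)) > r_pq(λ_k,λ_l)`, which provides the desired formula").
[cite: Dubois2009, proof of Prop. 3.3, (3.21)] -/
theorem re_pos_of_mem_duboisDisc {x y : Fin n → ℂ} {k l : Fin n} {θ : ℝ} (hθ0 : 0 < θ)
    (hθ1 : θ ≤ 1) (hρ : 0 < (x k * conj (x l)).re)
    (hyp : θ⁻¹ * ‖x l * y k - x k * y l‖ < (conj (x l) * y k + conj (x k) * y l).re)
    {z : ℂ} (hz : z ∈ Metric.closedBall (duboisCenter x y k l) (duboisRadius x y k l)) :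
    0 < z.re := by
  have hr0 : 0 ≤ duboisRadius x y k l := div_nonneg (norm_nonneg _) (by linarith)
  have hlt := duboisRadius_lt_mul_re_duboisCenter hθ0 hρ hyp
  have hcpos : 0 < (duboisCenter x y k l).re := by nlinarith
  have hrc : duboisRadius x y k l < (duboisCenter x y k l).re := by nlinarith
  rw [Metric.mem_closedBall, dist_eq_norm] at hz
  have h1 : |(z - duboisCenter x y k l).re| ≤ ‖z - duboisCenter x y k l‖ :=
    Complex.abs_re_le_norm _
  rw [Complex.sub_re, abs_le] at h1
  linarith [h1.1]

/-- The Poincaré diameter of a disc `D̄_pq(λ_k,λ_l)` is at most `log((1+θ)/(1−θ))` under the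
hypothesis of Thm 3.6 ("so by (3.21), `Δ₂ ≤ 3 log((1+θ)/(1−θ))`" — the per-disc bound).
[cite: Dubois2009, proof of Thm 3.6] -/
theorem poincareExp_le_of_mem_duboisDisc {x y : Fin n → ℂ} {k l : Fin n} {θ : ℝ} (hθ0 : 0 < θ)
    (hθ1 : θ < 1) (hρ : 0 < (x k * conj (x l)).re)
    (hyp : θ⁻¹ * ‖x l * y k - x k * y l‖ < (conj (x l) * y k + conj (x k) * y l).re)
    {z w : ℂ} (hz : z ∈ Metric.closedBall (duboisCenter x y k l) (duboisRadius x y k l))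
    (hw : w ∈ Metric.closedBall (duboisCenter x y k l) (duboisRadius x y k l)) :
    poincareExp z w ≤ (1 + θ) / (1 - θ) := by
  have hr0 : 0 ≤ duboisRadius x y k l := div_nonneg (norm_nonneg _) (by linarith)
  have hlt := duboisRadius_lt_mul_re_duboisCenter hθ0 hρ hyp
  have hcpos : 0 < (duboisCenter x y k l).re := by nlinarith
  have hrc : duboisRadius x y k l < (duboisCenter x y k l).re := by nlinarith
  rw [Metric.mem_closedBall, dist_eq_norm] at hz hw
  calc poincareExp z w
      ≤ ((duboisCenter x y k l).re + duboisRadius x y k l) /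
          ((duboisCenter x y k l).re - duboisRadius x y k l) :=
        poincareExp_le_of_mem_closedBall hr0 hrc hz hw
    _ ≤ (1 + θ) / (1 - θ) := by
        rw [div_le_div_iff₀ (by linarith) (by linarith)]
        nlinarith

variable {θ σ : ℝ} {A : Matrix (Fin n) (Fin n) ℂ}

/-- (3.20) with `k = l` says that every row `λ_k` lies in `Int ℂⁿ₊` ("letting `k = l = j`, we have
`λ_j ∈ Int ℂⁿ₊`"). [cite: Dubois2009, proof of Prop. 3.3] -/
theorem rows_mem_rughConeInt
    (h320 : ∀ k l p q, ‖A k p * A l q - A k q * A l p‖ <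
      (conj (A k p) * A l q + conj (A k q) * A l p).re)
    (k : Fin n) : A k ∈ rughConeInt n := by
  intro p q
  have h := h320 k k p q
  have e1 : A k p * A k q - A k q * A k p = 0 := by ring
  have e2 : (conj (A k p) * A k q + conj (A k q) * A k p).re = 2 * (A k p * conj (A k q)).re := by
    simp only [Complex.add_re, Complex.mul_re, Complex.conj_re, Complex.conj_im]
    ring
  rw [e1, norm_zero, e2] at h
  linarith

/-- The hypothesis of Thm 3.6 implies (3.20) (as `θ⁻¹ ≥ 1`). [cite: Dubois2009, Thm 3.6] -/
theorem strict_of_theta_hyp (hθ0 : 0 < θ) (hθ1 : θ < 1)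
    (hA1 : ∀ k l p q, θ⁻¹ * ‖A k p * A l q - A k q * A l p‖ <
      (conj (A k p) * A l q + conj (A k q) * A l p).re) :
    ∀ k l p q, ‖A k p * A l q - A k q * A l p‖ <
      (conj (A k p) * A l q + conj (A k q) * A l p).re := by
  intro k l p q
  refine lt_of_le_of_lt ?_ (hA1 k l p q)
  have h1 : 1 ≤ θ⁻¹ := (one_le_inv₀ hθ0).2 hθ1.le
  have := norm_nonneg (A k p * A l q - A k q * A l p)
  nlinarith

/-- Under (3.20), `A` maps `ℂⁿ₊ ∖ {0}` into `Int ℂⁿ₊` — Proposition 3.3 (⇐), i.e.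
`Dubois2009_thm_1_1_iff_holds` of `ComplexConeContractionProofs.lean`.
[cite: Dubois2009, Prop. 3.3, Thm 1.1] -/
theorem mulVec_mem_rughConeInt
    (h320 : ∀ k l p q, ‖A k p * A l q - A k q * A l p‖ <
      (conj (A k p) * A l q + conj (A k q) * A l p).re)
    {x : Fin n → ℂ} (hx : x ∈ rughCone n) (hx0 : x ≠ 0) : A.mulVec x ∈ rughConeInt n :=
  (Dubois2009_thm_1_1_iff_holds n A).2 h320 x hx hx0

/-- For `u = A x`, `x ∈ ℂⁿ₊ ∖ {0}`, the quotient `u_l / u_k` lies in `E_{Int ℂⁿ₊}(λ_k, λ_l)`, i.e.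
`(u_l/u_k) λ_k − λ_l ∉ Int ℂⁿ₊` — it pairs to zero with `x` (Lemma 3.1; print, proof of
Prop. 3.5: "the ratios `u_l/u_k` and `v_l/v_k` belong to `E_{Int ℂⁿ₊}(λ_k, λ_l)`").
[cite: Dubois2009, proofs of Prop. 3.3 and Prop. 3.5] -/
theorem exists_re_nonpos_mulVec_div
    (h320 : ∀ k l p q, ‖A k p * A l q - A k q * A l p‖ <
      (conj (A k p) * A l q + conj (A k q) * A l p).re)
    {x : Fin n → ℂ} (hx : x ∈ rughCone n) (hx0 : x ≠ 0) (k l : Fin n) :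
    ∃ p q, (((A.mulVec x l / A.mulVec x k) * A k p - A l p) *
      conj ((A.mulVec x l / A.mulVec x k) * A k q - A l q)).re ≤ 0 := by
  set z := A.mulVec x l / A.mulVec x k with hz
  have hk : A.mulVec x k ≠ 0 := ne_zero_of_mem_rughConeInt (mulVec_mem_rughConeInt h320 hx hx0) k
  have hmv : ∀ i, A.mulVec x i = ∑ p, A i p * x p := fun i => rfl
  have hw : (fun j => z * A k j - A l j) ∉ rughConeInt n := by
    intro hw
    apply sum_mul_ne_zero_of_mem_rughConeInt hw hx hx0
    calc ∑ p, (z * A k p - A l p) * x p = z * A.mulVec x k - A.mulVec x l := by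
          rw [hmv k, hmv l, Finset.mul_sum, ← Finset.sum_sub_distrib]
          exact Finset.sum_congr rfl fun p _ => by ring
      _ = 0 := by rw [hz, div_mul_cancel₀ _ hk, sub_self]
  simp only [rughConeInt, mem_setOf_eq, not_forall, not_lt] at hw
  exact hw

/-- The estimate (3.23)–(3.25) for ONE point of `E_{Int}(U, V)` lying in the disc `D̄_kl(U, V)`:
with `P = exp ρ(V_l/V_k, U_l/U_k)`, `|z| |U_k| ≤ P |V_k|` and `|V_k| ≤ P |z| |U_k|`.
[cite: Dubois2009, (3.23)–(3.25)] -/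
theorem duboisE_point_bounds {U V : Fin n → ℂ} (hU : U ∈ rughConeInt n) (hV : V ∈ rughConeInt n)
    {z : ℂ} {k l : Fin n} (hz : ((z * U k - V k) * conj (z * U l - V l)).re ≤ 0) :
    ‖z‖ * ‖U k‖ ≤ poincareExp (V l / V k) (U l / U k) * ‖V k‖ ∧
      ‖V k‖ ≤ poincareExp (V l / V k) (U l / U k) * (‖z‖ * ‖U k‖) := by
  have hUk : U k ≠ 0 := ne_zero_of_mem_rughConeInt hU k
  have hVk : V k ≠ 0 := ne_zero_of_mem_rughConeInt hV k
  have hUk' : conj (U k) ≠ 0 := (map_ne_zero _).2 hUk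
  have hVk' : conj (V k) ≠ 0 := (map_ne_zero _).2 hVk
  set a := V l / V k with ha_def
  set b := U l / U k with hb_def
  set ζ := z * U k / V k with hζ_def
  have ha : 0 < a.re := div_re_pos (hV l k)
  have hb : 0 < b.re := div_re_pos (hU l k)
  have hζ : ((ζ - 1) * conj (ζ * b - a)).re ≤ 0 := by
    have e : (z * U k - V k) * conj (z * U l - V l) =
        (V k * conj (V k)) * ((ζ - 1) * conj (ζ * b - a)) := by
      simp only [hζ_def, ha_def, hb_def, map_sub, map_mul, map_div₀]
      field_simp
    have e2 : ((z * U k - V k) * conj (z * U l - V l)).re =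
        Complex.normSq (V k) * ((ζ - 1) * conj (ζ * b - a)).re := by
      rw [e, Complex.mul_conj, Complex.re_ofReal_mul]
    rw [e2] at hz
    by_contra hcon
    push Not at hcon
    have := mul_pos (Complex.normSq_pos.2 hVk) hcon
    linarith
  obtain ⟨h1, h2⟩ := norm_bounds_of_re_nonpos hb hζ
  have hP : (‖a + conj b‖ + ‖a - b‖) / (2 * b.re) ≤ poincareExp a b := phi_le_poincareExp ha hb
  have hP' : (‖b + conj a‖ + ‖b - a‖) / (2 * a.re) ≤ poincareExp b a := phi_le_poincareExp hb ha
  have hsym : ‖b + conj a‖ + ‖b - a‖ = ‖a + conj b‖ + ‖a - b‖ := by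
    have : b + conj a = conj (a + conj b) := by simp [add_comm]
    rw [this, Complex.norm_conj, norm_sub_rev]
  rw [hsym, poincareExp_comm b a, div_le_iff₀ (by positivity)] at hP'
  rw [div_le_iff₀ (by positivity)] at hP
  have hnζ : ‖ζ‖ * ‖V k‖ = ‖z‖ * ‖U k‖ := by
    rw [hζ_def, norm_div, norm_mul, div_mul_cancel₀ _ (norm_ne_zero_iff.2 hVk)]
  constructor
  · have hζP : ‖ζ‖ ≤ poincareExp a b :=
      le_of_mul_le_mul_right (h1.trans hP) (by positivity)
    calc ‖z‖ * ‖U k‖ = ‖ζ‖ * ‖V k‖ := hnζ.symm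
      _ ≤ poincareExp a b * ‖V k‖ := mul_le_mul_of_nonneg_right hζP (norm_nonneg _)
  · have h3 : 2 * a.re ≤ ‖ζ‖ * (poincareExp a b * (2 * a.re)) :=
      h2.trans (mul_le_mul_of_nonneg_left hP' (norm_nonneg _))
    have h4 : 1 ≤ ‖ζ‖ * poincareExp a b := by
      have : 1 * (2 * a.re) ≤ ‖ζ‖ * poincareExp a b * (2 * a.re) := by
        rw [one_mul, mul_assoc]
        exact h3
      exact le_of_mul_le_mul_right this (by positivity)
    calc ‖V k‖ = 1 * ‖V k‖ := (one_mul _).symm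
      _ ≤ ‖ζ‖ * poincareExp a b * ‖V k‖ := mul_le_mul_of_nonneg_right h4 (norm_nonneg _)
      _ = poincareExp a b * (‖ζ‖ * ‖V k‖) := by ring
      _ = poincareExp a b * (‖z‖ * ‖U k‖) := by rw [hnζ]

/-- The chain of three discs (proof of Thm 3.6: "`a_lp/a_kp` and `a_lq/a_kq` both belong to
`D̄_pq`, so the disk `D̄_pq` intersects `D̄_qr` which in turn intersects `D̄_rs`"): for `u = A x`,
`v = A y`, `exp ρ(v_l/v_k, u_l/u_k) ≤ ((1+θ)/(1−θ))³` (this is `e^{2 · (3/2) log}` … i.e. the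
bound `ρ ≤ Δ₂ ≤ 3 log((1+θ)/(1−θ))`). [cite: Dubois2009, proof of Thm 3.6] -/
theorem poincareExp_mulVec_div_le (hθ0 : 0 < θ) (hθ1 : θ < 1)
    (hA1 : ∀ k l p q, θ⁻¹ * ‖A k p * A l q - A k q * A l p‖ <
      (conj (A k p) * A l q + conj (A k q) * A l p).re)
    {x y : Fin n → ℂ} (hx : x ∈ rughCone n) (hx0 : x ≠ 0) (hy : y ∈ rughCone n) (hy0 : y ≠ 0)
    (k l : Fin n) :
    poincareExp (A.mulVec y l / A.mulVec y k) (A.mulVec x l / A.mulVec x k) ≤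
      ((1 + θ) / (1 - θ)) ^ 3 := by
  have h320 := strict_of_theta_hyp hθ0 hθ1 hA1
  set T := (1 + θ) / (1 - θ) with hT
  have hT0 : 0 ≤ T := div_nonneg (by linarith) (by linarith)
  set b := A.mulVec x l / A.mulVec x k with hb
  set a := A.mulVec y l / A.mulVec y k with ha
  obtain ⟨p, q, hbpq⟩ := exists_re_nonpos_mulVec_div h320 hx hx0 k l
  obtain ⟨r, s, hars⟩ := exists_re_nonpos_mulVec_div h320 hy hy0 k l
  have hrow : A k ∈ rughConeInt n := rows_mem_rughConeInt h320 k
  have hAk : ∀ j, A k j ≠ 0 := ne_zero_of_mem_rughConeInt hrow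
  have hbD := (re_mul_conj_nonpos_iff_mem_closedBall (A k) (A l) q p (hrow q p) b).1 hbpq
  have haD := (re_mul_conj_nonpos_iff_mem_closedBall (A k) (A l) s r (hrow s r) a).1 hars
  set eq := A l q / A k q with heq
  set es := A l s / A k s with hes
  have heqD : eq ∈ Metric.closedBall (duboisCenter (A k) (A l) q p)
      (duboisRadius (A k) (A l) q p) := by
    apply (re_mul_conj_nonpos_iff_mem_closedBall (A k) (A l) q p (hrow q p) eq).1
    have : eq * A k q - A l q = 0 := by rw [heq, div_mul_cancel₀ _ (hAk q), sub_self]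
    rw [this, map_zero, mul_zero, Complex.zero_re]
  have hesD : es ∈ Metric.closedBall (duboisCenter (A k) (A l) s r)
      (duboisRadius (A k) (A l) s r) := by
    apply (re_mul_conj_nonpos_iff_mem_closedBall (A k) (A l) s r (hrow s r) es).1
    have : es * A k s - A l s = 0 := by rw [hes, div_mul_cancel₀ _ (hAk s), sub_self]
    rw [this, map_zero, mul_zero, Complex.zero_re]
  have hbre : 0 < b.re := re_pos_of_mem_duboisDisc hθ0 hθ1.le (hrow q p) (hA1 k l p q) hbD
  have hare : 0 < a.re := re_pos_of_mem_duboisDisc hθ0 hθ1.le (hrow s r) (hA1 k l r s) haD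
  have heqre : 0 < eq.re := re_pos_of_mem_duboisDisc hθ0 hθ1.le (hrow q p) (hA1 k l p q) heqD
  have hesre : 0 < es.re := re_pos_of_mem_duboisDisc hθ0 hθ1.le (hrow s r) (hA1 k l r s) hesD
  have f1 : poincareExp a es ≤ T :=
    poincareExp_le_of_mem_duboisDisc hθ0 hθ1 (hrow s r) (hA1 k l r s) haD hesD
  have f3 : poincareExp eq b ≤ T :=
    poincareExp_le_of_mem_duboisDisc hθ0 hθ1 (hrow q p) (hA1 k l p q) heqD hbD
  have f2 : poincareExp es eq ≤ T := by
    have hes' := hesre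
    have heq' := heqre
    rw [hes] at hes' ⊢
    rw [heq] at heq' ⊢
    apply poincareExp_div_div_le hθ1 (hAk s) (hAk q) hes' heq'
    have h := hA1 k l q s
    rw [mul_comm (A k s) (A l q)] at h
    have e2 : (conj (A k q) * A l s + conj (A k s) * A l q).re =
        (conj (A k q) * A l s + conj (A l q) * A k s).re := by
      simp only [Complex.add_re, Complex.mul_re, Complex.conj_re, Complex.conj_im]
      ring
    rw [e2] at h
    have h' := (inv_mul_lt_iff₀ hθ0).1 h
    have h'' := Complex.re_le_norm (conj (A k q) * A l s + conj (A l q) * A k s)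
    nlinarith
  calc poincareExp a b ≤ poincareExp a es * poincareExp es b :=
        poincareExp_triangle hare hesre hbre
    _ ≤ poincareExp a es * (poincareExp es eq * poincareExp eq b) :=
        mul_le_mul_of_nonneg_left (poincareExp_triangle hesre heqre hbre)
          (poincareExp_nonneg hare hesre)
    _ ≤ T * (T * T) :=
        mul_le_mul f1 (mul_le_mul f2 f3 (poincareExp_nonneg heqre hbre) hT0)
          (mul_nonneg (poincareExp_nonneg hesre heqre) (poincareExp_nonneg heqre hbre)) hT0
    _ = T ^ 3 := by ring

/-- **The diameter estimate of Thm 3.6 in multiplicative form**: any two points `z, w` of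
`E_{ℂⁿ₊}(A x, A y)` satisfy `|z| ≤ σ² ((1+θ)/(1−θ))⁸ |w|` — Prop. 3.5's `Δ ≤ Δ₁ + 2Δ₂` with
`Δ₂ ≤ 3 log((1+θ)/(1−θ))` and `Δ₁ ≤ 2 log((1+θ)/(1−θ)) + 2 log σ`.
[cite: Dubois2009, Prop. 3.5, Thm 3.6] -/
theorem norm_le_of_mem_duboisE (hθ0 : 0 < θ) (hθ1 : θ < 1)
    (hA : ∀ k l p q, θ⁻¹ * ‖A k p * A l q - A k q * A l p‖ <
        (conj (A k p) * A l q + conj (A k q) * A l p).re ∧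
      ‖A k p * A l q‖ ≤ σ ^ 2 * ‖A k q * A l p‖)
    {x y : Fin n → ℂ} (hx : x ∈ rughCone n) (hx0 : x ≠ 0) (hy : y ∈ rughCone n) (hy0 : y ≠ 0)
    {z w : ℂ} (hz : z ∈ duboisE (rughCone n) (A.mulVec x) (A.mulVec y))
    (hw : w ∈ duboisE (rughCone n) (A.mulVec x) (A.mulVec y)) :
    ‖z‖ ≤ σ ^ 2 * ((1 + θ) / (1 - θ)) ^ 8 * ‖w‖ := by
  have hA1 := fun k l p q => (hA k l p q).1
  have h320 := strict_of_theta_hyp hθ0 hθ1 hA1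
  have hT0 : 0 ≤ (1 + θ) / (1 - θ) := div_nonneg (by linarith) (by linarith)
  set u := A.mulVec x with hu
  set v := A.mulVec y with hv
  have huI : u ∈ rughConeInt n := mulVec_mem_rughConeInt h320 hx hx0
  have hvI : v ∈ rughConeInt n := mulVec_mem_rughConeInt h320 hy hy0
  simp only [duboisE, mem_setOf_eq, rughCone, not_forall, not_le, Pi.sub_apply, Pi.smul_apply,
    smul_eq_mul] at hz hw
  obtain ⟨k, l, hkl⟩ := hz
  obtain ⟨p, q, hpq⟩ := hw
  -- the two points of `E(u, v)` (level of `u, v`)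
  have B1 := (duboisE_point_bounds huI hvI hkl.le).1
  have B2 := (duboisE_point_bounds huI hvI hpq.le).2
  have C1 := poincareExp_mulVec_div_le hθ0 hθ1 hA1 hx hx0 hy hy0 k l
  have C2 := poincareExp_mulVec_div_le hθ0 hθ1 hA1 hx hx0 hy hy0 p q
  -- the two points `v_k/v_p`, `u_k/u_p` of `E(λ_p, λ_k)` (level of the rows; the `Δ₁` part)
  obtain ⟨k', l', hz'⟩ := exists_re_nonpos_mulVec_div h320 hy hy0 p k
  obtain ⟨p', q', hw'⟩ := exists_re_nonpos_mulVec_div h320 hx hx0 p k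
  have rowp : A p ∈ rughConeInt n := rows_mem_rughConeInt h320 p
  have rowk : A k ∈ rughConeInt n := rows_mem_rughConeInt h320 k
  have B3 := (duboisE_point_bounds rowp rowk hz').1
  have B4 := (duboisE_point_bounds rowp rowk hw').2
  have C3 : poincareExp (A k l' / A k k') (A p l' / A p k') ≤ (1 + θ) / (1 - θ) := by
    apply poincareExp_div_div_le hθ1 (ne_zero_of_mem_rughConeInt rowk k')
      (ne_zero_of_mem_rughConeInt rowp k') (div_re_pos (rowk l' k')) (div_re_pos (rowp l' k'))
    have h' := (inv_mul_lt_iff₀ hθ0).1 (hA1 p k k' l')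
    have h'' := Complex.re_le_norm (conj (A p k') * A k l' + conj (A p l') * A k k')
    nlinarith
  have C4 : poincareExp (A k q' / A k p') (A p q' / A p p') ≤ (1 + θ) / (1 - θ) := by
    apply poincareExp_div_div_le hθ1 (ne_zero_of_mem_rughConeInt rowk p')
      (ne_zero_of_mem_rughConeInt rowp p') (div_re_pos (rowk q' p')) (div_re_pos (rowp q' p'))
    have h' := (inv_mul_lt_iff₀ hθ0).1 (hA1 p k p' q')
    have h'' := Complex.re_le_norm (conj (A p p') * A k q' + conj (A p q') * A k p')
    nlinarith
  have S : ‖A k k'‖ * ‖A p p'‖ ≤ σ ^ 2 * (‖A k p'‖ * ‖A p k'‖) := by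
    have := (hA k p k' p').2
    rwa [norm_mul, norm_mul] at this
  generalize hT : (1 + θ) / (1 - θ) = T at hT0 C1 C2 C3 C4 ⊢
  -- positivity of the norms involved
  have huk : 0 < ‖u k‖ := norm_pos_iff.2 (ne_zero_of_mem_rughConeInt huI k)
  have hup : 0 < ‖u p‖ := norm_pos_iff.2 (ne_zero_of_mem_rughConeInt huI p)
  have hvk : 0 < ‖v k‖ := norm_pos_iff.2 (ne_zero_of_mem_rughConeInt hvI k)
  have hvp : 0 < ‖v p‖ := norm_pos_iff.2 (ne_zero_of_mem_rughConeInt hvI p)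
  have hakk : 0 < ‖A k k'‖ := norm_pos_iff.2 (ne_zero_of_mem_rughConeInt rowk k')
  have hakp : 0 < ‖A k p'‖ := norm_pos_iff.2 (ne_zero_of_mem_rughConeInt rowk p')
  have hapk : 0 < ‖A p k'‖ := norm_pos_iff.2 (ne_zero_of_mem_rughConeInt rowp k')
  have happ : 0 < ‖A p p'‖ := norm_pos_iff.2 (ne_zero_of_mem_rughConeInt rowp p')
  -- bookkeeping
  have E1 : ‖z‖ * ‖u k‖ ≤ T ^ 3 * ‖v k‖ := B1.trans (mul_le_mul_of_nonneg_right C1 hvk.le)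
  have E2 : ‖v p‖ ≤ T ^ 3 * (‖w‖ * ‖u p‖) :=
    B2.trans (mul_le_mul_of_nonneg_right C2 (by positivity))
  have E3 : ‖v k‖ * ‖A p k'‖ ≤ T * ‖A k k'‖ * ‖v p‖ := by
    have h := B3.trans (mul_le_mul_of_nonneg_right C3 hakk.le)
    rw [norm_div, div_mul_eq_mul_div, div_le_iff₀ hvp] at h
    exact h
  have E4 : ‖A k p'‖ * ‖u p‖ ≤ T * ‖u k‖ * ‖A p p'‖ := by
    have h := B4.trans (mul_le_mul_of_nonneg_right C4 (by positivity))
    rw [norm_div, div_mul_eq_mul_div, mul_div_assoc', le_div_iff₀ hup] at h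
    calc ‖A k p'‖ * ‖u p‖ ≤ T * (‖u k‖ * ‖A p p'‖) := h
      _ = T * ‖u k‖ * ‖A p p'‖ := by ring
  have E5 : ‖v k‖ * ‖u p‖ ≤ σ ^ 2 * T ^ 2 * (‖v p‖ * ‖u k‖) := by
    have h1 := mul_le_mul E3 E4 (by positivity)
      (mul_nonneg (mul_nonneg hT0 (norm_nonneg _)) (norm_nonneg _))
    have h2 : T * ‖A k k'‖ * ‖v p‖ * (T * ‖u k‖ * ‖A p p'‖) ≤
        T ^ 2 * ‖v p‖ * ‖u k‖ * (σ ^ 2 * (‖A k p'‖ * ‖A p k'‖)) := by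
      have := mul_le_mul_of_nonneg_left S
        (mul_nonneg (mul_nonneg (pow_nonneg hT0 2) (norm_nonneg (v p))) (norm_nonneg (u k)))
      calc T * ‖A k k'‖ * ‖v p‖ * (T * ‖u k‖ * ‖A p p'‖)
          = T ^ 2 * ‖v p‖ * ‖u k‖ * (‖A k k'‖ * ‖A p p'‖) := by ring
        _ ≤ _ := this
    have h3 := h1.trans h2
    have hpos : 0 < ‖A p k'‖ * ‖A k p'‖ := by positivity
    refine le_of_mul_le_mul_right ?_ hpos
    calc ‖v k‖ * ‖u p‖ * (‖A p k'‖ * ‖A k p'‖) = ‖v k‖ * ‖A p k'‖ * (‖A k p'‖ * ‖u p‖) := by ring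
      _ ≤ _ := h3
      _ = σ ^ 2 * T ^ 2 * (‖v p‖ * ‖u k‖) * (‖A p k'‖ * ‖A k p'‖) := by ring
  have hpos2 : 0 < ‖u k‖ * ‖u p‖ := by positivity
  refine le_of_mul_le_mul_right ?_ hpos2
  calc ‖z‖ * (‖u k‖ * ‖u p‖) = (‖z‖ * ‖u k‖) * ‖u p‖ := by ring
    _ ≤ T ^ 3 * ‖v k‖ * ‖u p‖ := mul_le_mul_of_nonneg_right E1 hup.le
    _ = T ^ 3 * (‖v k‖ * ‖u p‖) := by ring
    _ ≤ T ^ 3 * (σ ^ 2 * T ^ 2 * (‖v p‖ * ‖u k‖)) :=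
        mul_le_mul_of_nonneg_left E5 (pow_nonneg hT0 3)
    _ = T ^ 5 * σ ^ 2 * ‖u k‖ * ‖v p‖ := by ring
    _ ≤ T ^ 5 * σ ^ 2 * ‖u k‖ * (T ^ 3 * (‖w‖ * ‖u p‖)) :=
        mul_le_mul_of_nonneg_left E2
          (mul_nonneg (mul_nonneg (pow_nonneg hT0 5) (sq_nonneg σ)) (norm_nonneg _))
    _ = σ ^ 2 * T ^ 8 * ‖w‖ * (‖u k‖ * ‖u p‖) := by ring

/-- If all moduli of `E_C(x,y)` are within a factor `K ≥ 1` of each other then `δ_C(x,y) ≤ log K`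
(Def. 2: `δ = log (sup |E| / inf |E|)`). [cite: Dubois2009, Def. 2] -/
theorem duboisDelta_le_log {V : Type*} [AddCommGroup V] [Module ℂ V] (C : Set V) (x y : V)
    {K : ℝ} (hK : 1 ≤ K) (h : ∀ z ∈ duboisE C x y, ∀ w ∈ duboisE C x y, ‖z‖ ≤ K * ‖w‖) :
    duboisDelta C x y ≤ ((Real.log K : ℝ) : EReal) := by
  classical
  unfold duboisDelta
  split_ifs with hli
  · have hK0 : 0 < K := by linarith
    have hK' : ENNReal.ofReal K ≠ 0 := (ENNReal.ofReal_pos.2 hK0).ne'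
    have hcoe : ∀ c : ℂ, ENNReal.ofReal ‖c‖ = (‖c‖₊ : ℝ≥0∞) := fun c =>
      ENNReal.ofReal_eq_coe_nnreal (norm_nonneg c)
    rw [← ENNReal.log_ofReal_of_pos hK0]
    apply ENNReal.log_monotone
    apply ENNReal.div_le_of_le_mul
    refine iSup₂_le fun z hz => ?_
    rw [ENNReal.mul_iInf_of_ne hK' ENNReal.ofReal_ne_top]
    refine le_iInf fun w => ?_
    rw [ENNReal.mul_iInf_of_ne hK' ENNReal.ofReal_ne_top]
    refine le_iInf fun hw => ?_
    calc (‖z‖₊ : ℝ≥0∞) = ENNReal.ofReal ‖z‖ := (hcoe z).symm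
      _ ≤ ENNReal.ofReal (K * ‖w‖) := ENNReal.ofReal_le_ofReal (h z hz w hw)
      _ = ENNReal.ofReal K * ENNReal.ofReal ‖w‖ := ENNReal.ofReal_mul hK0.le
      _ = ENNReal.ofReal K * (‖w‖₊ : ℝ≥0∞) := by rw [hcoe w]
  · exact_mod_cast Real.log_nonneg hK

/-- **Dubois 2009, Theorem 3.6** — discharge of `Dubois2009_thm_3_6`, following the printed proof
(pp. 12–13) on top of Prop. 3.3 (`Dubois2009_thm_1_1_iff_holds`), Lemma 3.2
(`re_mul_conj_nonpos_iff_mem_closedBall`, in the tree) and Prop. 3.5's chain (3.23)–(3.25)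
(`duboisE_point_bounds`, `poincareExp_mulVec_div_le`, `norm_le_of_mem_duboisE`); the `δ`-diameter with
respect to the closed cone `ℂⁿ₊` is bounded through `E_{ℂⁿ₊} ⊆ E_{Int ℂⁿ₊}`.
[cite: Dubois2009, Thm 3.6; Thm 1.1] -/
theorem Dubois2009_thm_3_6_holds : Dubois2009_thm_3_6 := by
  intro n θ σ hθ0 hθ1 hσ A hA
  have hA1 := fun k l p q => (hA k l p q).1
  have h320 := strict_of_theta_hyp hθ0 hθ1 hA1
  refine ⟨fun v hv hv0 => mulVec_mem_rughConeInt h320 hv hv0, ?_⟩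
  intro x hx hx0 y hy hy0
  set T := (1 + θ) / (1 - θ) with hT
  have hT1 : 1 < T := by
    rw [hT, lt_div_iff₀ (by linarith)]
    linarith
  have hK : 1 ≤ σ ^ 2 * T ^ 8 :=
    one_le_mul_of_one_le_of_one_le (one_le_pow₀ hσ.le) (one_le_pow₀ hT1.le)
  calc duboisDelta (rughCone n) (A.mulVec x) (A.mulVec y)
      ≤ ((Real.log (σ ^ 2 * T ^ 8) : ℝ) : EReal) :=
        duboisDelta_le_log _ _ _ hK fun z hz w hw =>
          norm_le_of_mem_duboisE hθ0 hθ1 hA hx hx0 hy hy0 hz hw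
    _ = ((8 * Real.log ((1 + θ) / (1 - θ)) + 2 * Real.log σ : ℝ) : EReal) := by
        congr 1
        rw [Real.log_mul (pow_pos (by linarith) 2).ne' (pow_pos (by linarith) 8).ne',
          Real.log_pow, Real.log_pow, ← hT]
        push_cast
        ring

end Thm36

end Literature.Dynamics.Contraction

end
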